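import Mathlib.Topology.Homotopy.Equiv
import Literature.Topology.FourManifolds.Trisections
import Literature.Topology.FourManifolds.HomotopySpheres
import HarnessLib

/-!
# Euler characteristic of a trisected 4-manifold — homotopy-sphere form (Gay–Kirby, Remark 2)

Topic `Literature/Topology/FourManifolds`; named fact (D-0014) requested by route
`SmoothPoincare4/GroupTrisection` (`wi-04028`), over `Literature.Topology.FourManifolds.IsTrisection` /
`Literature.Topology.FourManifolds.IsBalancedTrisection` (`Trisections.lean`) and `Literature.HomotopySphere 4` (`HomotopySpheres.lean`).

## The printed statements (arXiv TeX checked)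

* Gay–Kirby 2016, Remark 2 (right after Def. 1): for a closed, connected, oriented 4-manifold `X`
  with a `(g, k)`-trisection, "the triple intersection `X₁ ∩ X₂ ∩ X₃` is a surface of genus `g` and
  `χ(X) = 2 + g − 3k`. Thus `k` is determined by `X` and `g`". (From the handle decomposition of
  Thm. 4: one `0`-handle, `k` `1`-handles, `g − k` `2`-handles, `k` `3`-handles, one `4`-handle;
  `1 − k + (g − k) − k + 1 = 2 + g − 3k`. Checks: `S⁴` `(0,0)`: `2`; `ℂP²` `(1,0)`: `3`;
  `S¹ × S³` `(1,1)`: `0`.)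
* Meier–Schirmer–Zupan 2016, Remark 3.12 (arXiv v1 numbering; unbalanced `(g; k₁, k₂, k₃)`):
  the induced handle decomposition gives the Euler characteristic (printed there with the overall
  sign of `g − Σ kᵢ` flipped, a typo: `ℂP²` has `χ = 3`, `(g; k) = (1; 0,0,0)`), and "it follows
  that any trisection of `S⁴` must satisfy `g = k₁ + k₂ + k₃`".
* Abrams–Gay–Kirby 2018, proof of Cor. 4: a `(3k, k)`-trisected simply connected 4-manifold has
  `χ = 2`, i.e. is a homotopy `S⁴`; conversely (the direction the route uses) a homotopy 4-sphere
  has `χ(X) = χ(S⁴) = 2`, so a `(g; k₁, k₂, k₃)`-trisection of it has `g = k₁ + k₂ + k₃`, and a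
  balanced `(g, k)`-trisection has `g = 3k`.

## What is vendored, and why in this form

Neither Mathlib nor the tree has the Euler characteristic of a (compact) manifold or of a handle
decomposition (searched `eulerChar`, `Euler char`, `betti`: only `HomologicalComplex.eulerChar`
and the incidence-algebra `eulerChar`), so `χ(X) = 2 + g − Σ kᵢ` cannot be stated today without a
new definition. We therefore vendor the consequence the route consumes, which needs no `χ`:

* `trisection_genus_eq_sum_of_homotopyEquiv_sphere` (named fact, `def … : Prop`): a closed oriented
  smooth 4-manifold `X` homotopy equivalent to `S⁴` with a `(g; k₀, k₁, k₂)`-trisection has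
  `g = k₀ + k₁ + k₂` [GK Remark 2 + `χ(X) = χ(S⁴) = 2`; MSZ Remark 3.12 for `X = S⁴`].
  Connectedness of `X` is not assumed separately: it follows from `X ≃ₕ S⁴`.
* Proved corollaries: `.balanced` (`IsBalancedTrisection X g k S → X ≃ₕ S⁴ → g = 3 * k`) and
  `.homotopySphere` — the requested signature
  `∀ (S : HomotopySphere 4) (g k) (T), IsBalancedTrisection S.carrier g k T → g = 3 * k`;
  `.le` (`kᵢ ≤ g`), `.three_dvd`, and the `@[deprecated]` record
  `.exists_isBalancedTrisection_three_mul` (with the first vendoring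
  `Literature.Topology.FourManifolds.exists_isBalancedTrisection` of GK Thm. 4 as hypothesis — a
  mis-stated, in-tree-refuted fact, itself an `@[deprecated]` record of `Trisections.lean` since
  the verdict clean-up of 2026-08-15 — so that this corollary is vacuous; its live form is
  `gkTrisection_genus_eq_sum_of_homotopyEquiv_sphere.exists_isBalancedGKTrisection_three_mul`
  below, over `exists_isBalancedGKTrisection`).

Nothing is asserted by the `def`; users take `(h : trisection_genus_eq_sum_of_homotopyEquiv_sphere)`.

## The same fact over Gay–Kirby trisections with corners (`IsGKTrisection`)

`Literature.Topology.FourManifolds.IsTrisection` is unsatisfiable (`TrisectionsRefutation.lean`: its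
clause (ii) forbids the corners of the sectors along the central surface), so the fact above is
vacuously true and useless to its consumers.  The corrected, non-vacuous predicate is
`Literature.Topology.FourManifolds.IsGKTrisection` (`Trisections.lean`; GK's genus-`0` trisection
of `S⁴` is proved to satisfy it in `SphereTrisectionsSectors.lean`).  The last section re-vendors
the printed remark over it, with the same corollaries:

* `gkTrisection_genus_eq_sum_of_homotopyEquiv_sphere` (named fact): a closed oriented smooth `X`
  homotopy equivalent to `S⁴` with an `IsGKTrisection` of type `(g; k₀, k₁, k₂)` has
  `g = k₀ + k₁ + k₂` [GK Remark 2; MSZ Remark 3.12 "any trisection of `S⁴` must satisfy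
  `g = k₁ + k₂ + k₃`"; `χ` is a homotopy invariant, AGK proof of Cor. 4];
* proved corollaries `.balanced` (`g = 3k`), `.homotopySphere`, `.le`, `.three_dvd`,
  `.exists_isBalancedGKTrisection_three_mul` (with `exists_isBalancedGKTrisection`, GK Thm. 4), and
  the arithmetic remark used by the barrier catalogue
  (`Literature/Barriers/SmoothPoincare4/LowGenusTrisectionsStandard.lean`):
  `.exists_le_add_one_of_le_two` — a trisected homotopy 4-sphere of genus `g ≤ 2` has some
  `kᵢ ≥ g - 1`, i.e. lies in the range of Meier–Schirmer–Zupan's Thm. 1.2 (the possible types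
  being `(0;0,0,0)`, `(1;1,0,0)`, `(2;2,0,0)`, `(2;1,1,0)` up to relabelling).

## References

* [GayKirby2016] D. Gay, R. Kirby, *Trisecting 4-manifolds*, Geom. Topol. 20 (2016) 3097–3132
  (arXiv:1205.1565), Def. 1, Remark 2, Thm. 4.
* [MeierSchirmerZupan2016] J. Meier, T. Schirmer, A. Zupan, *Classification of trisections and the
  generalized property R conjecture*, Proc. AMS 144 (2016) 4983–4997 (arXiv:1507.06561),
  Remark 3.12.
* [AbramsGayKirby2018] A. Abrams, D. Gay, R. Kirby, *Group trisections and smooth 4-manifolds*,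
  Geom. Topol. 22 (2018) 1537–1545 (arXiv:1605.06731), Cor. 4 and its proof.
-/

noncomputable section

open scoped Manifold ContDiff
open Set ContinuousMap

namespace Literature.Topology.FourManifolds

universe u

/-- The round 4-sphere `S⁴ ⊆ ℝ⁵` with Mathlib's smooth structure. [folklore] -/
local notation "𝕊⁴" => (Metric.sphere (0 : EuclideanSpace ℝ (Fin 5)) 1)

/-- **Gay–Kirby 2016, Remark 2 (Euler characteristic of a trisection), homotopy-sphere form.**
Let `X` be a closed, oriented smooth 4-manifold with a `(g; k₀, k₁, k₂)`-trisection
`S : Fin 3 → Set X`. Gay–Kirby (balanced case) and Meier–Schirmer–Zupan (unbalanced case) note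
that the induced handle decomposition (one `0`-handle, `k₀` `1`-handles, `g − k₁` `2`-handles,
`k₂` `3`-handles, one `4`-handle) gives `χ(X) = 2 + g − k₀ − k₁ − k₂`, so that "any trisection of
`S⁴` must satisfy `g = k₁ + k₂ + k₃`" (MSZ). If `X` is homotopy equivalent to `S⁴` then
`χ(X) = χ(S⁴) = 2` (this is how Abrams–Gay–Kirby, proof of Cor. 4, pass between `(3k, k)` and
homotopy 4-spheres), hence `g = k₀ + k₁ + k₂`. Vendored in this `χ`-free form because the tree has
no Euler characteristic of manifolds; `X` connected is implied by `X ≃ₕ S⁴` and not assumed.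
[cite: GayKirby2016, Remark 2] [cite: MeierSchirmerZupan2016, Remark 3.12]
[cite: AbramsGayKirby2018, Cor. 4] -/
def trisection_genus_eq_sum_of_homotopyEquiv_sphere : Prop :=
  ∀ (X : Type u) [TopologicalSpace X] [T2Space X] [SecondCountableTopology X]
    [ChartedSpace (EuclideanSpace ℝ (Fin 4)) X] [IsManifold (𝓡 4) ∞ X] [CompactSpace X]
    (_ : SmoothOrientation (𝓡 4) X) (g : ℕ) (k : Fin 3 → ℕ) (S : Fin 3 → Set X),
    IsTrisection X g k S → X ≃ₕ 𝕊⁴ → g = k 0 + k 1 + k 2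

namespace trisection_genus_eq_sum_of_homotopyEquiv_sphere

/-- Balanced form (Gay–Kirby Remark 2 with `χ = 2`; Abrams–Gay–Kirby, proof of Cor. 4): a
`(g, k)`-trisection of a closed oriented smooth 4-manifold homotopy equivalent to `S⁴` has
`g = 3k`. [cite: GayKirby2016, Remark 2] -/
theorem balanced (h : trisection_genus_eq_sum_of_homotopyEquiv_sphere.{u})
    (X : Type u) [TopologicalSpace X] [T2Space X] [SecondCountableTopology X]
    [ChartedSpace (EuclideanSpace ℝ (Fin 4)) X] [IsManifold (𝓡 4) ∞ X] [CompactSpace X]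
    (o : SmoothOrientation (𝓡 4) X) {g k : ℕ} {S : Fin 3 → Set X}
    (hS : IsBalancedTrisection X g k S) (e : X ≃ₕ 𝕊⁴) : g = 3 * k := by
  have := h X o g (fun _ => k) S hS.isTrisection e
  omega

/-- The requested form over the tree's oriented homotopy 4-spheres `Literature.HomotopySphere 4`: every
balanced `(g, k)`-trisection of a homotopy 4-sphere has `g = 3k` (so, with Gay–Kirby Thm. 4, every
homotopy 4-sphere has a `(3k, k)`-trisection). [cite: AbramsGayKirby2018, Cor. 4] -/
theorem homotopySphere (h : trisection_genus_eq_sum_of_homotopyEquiv_sphere.{0})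
    (M : HomotopySphere 4) (g k : ℕ) (T : Fin 3 → Set M.carrier)
    (hT : IsBalancedTrisection M.carrier g k T) : g = 3 * k :=
  h.balanced M.carrier M.orientation hT (Classical.choice M.nonempty_homotopyEquiv)

/-- Unbalanced consequence: each `kᵢ` is at most the genus, for a trisected homotopy 4-sphere
(in general `kᵢ ≤ g` is part of Gay–Kirby's Def. 1, `0 ≤ k ≤ g`). [cite: GayKirby2016, Def. 1] -/
theorem le (h : trisection_genus_eq_sum_of_homotopyEquiv_sphere.{u})
    (X : Type u) [TopologicalSpace X] [T2Space X] [SecondCountableTopology X]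
    [ChartedSpace (EuclideanSpace ℝ (Fin 4)) X] [IsManifold (𝓡 4) ∞ X] [CompactSpace X]
    (o : SmoothOrientation (𝓡 4) X) {g : ℕ} {k : Fin 3 → ℕ} {S : Fin 3 → Set X}
    (hS : IsTrisection X g k S) (e : X ≃ₕ 𝕊⁴) (i : Fin 3) : k i ≤ g := by
  have := h X o g k S hS e
  fin_cases i <;> simp only [Fin.zero_eta, Fin.mk_one, Fin.reduceFinMk] <;> omega

/-- Balanced homotopy 4-spheres of trisection genus `g` not divisible by `3` do not exist; e.g. a
homotopy 4-sphere has no balanced trisection of genus `1` or `2`. [cite: GayKirby2016, Remark 2] -/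
theorem three_dvd (h : trisection_genus_eq_sum_of_homotopyEquiv_sphere.{u})
    (X : Type u) [TopologicalSpace X] [T2Space X] [SecondCountableTopology X]
    [ChartedSpace (EuclideanSpace ℝ (Fin 4)) X] [IsManifold (𝓡 4) ∞ X] [CompactSpace X]
    (o : SmoothOrientation (𝓡 4) X) {g k : ℕ} {S : Fin 3 → Set X}
    (hS : IsBalancedTrisection X g k S) (e : X ≃ₕ 𝕊⁴) : 3 ∣ g :=
  ⟨k, h.balanced X o hS e⟩

-- names the `@[deprecated]` record `exists_isBalancedTrisection` of `Trisections.lean` (its hypothesis `hGK`);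
-- vacuous record kept for stability (verdict clean-up 2026-08-15); REMOVE-WHEN that record is deleted.
set_option linter.deprecated false in
/-- **Record — vacuous** (verdict clean-up 2026-08-15).  With the *first vendoring* of Gay–Kirby's
existence theorem (`Literature.Topology.FourManifolds.exists_isBalancedTrisection`, GK Thm. 4 over
the unsatisfiable `IsTrisection`) as hypothesis `hGK`: every (connected) homotopy 4-sphere admits
a `(3k, k)`-trisection for some `k` — the passage used by Abrams–Gay–Kirby, Cor. 4.  Since `hGK`
is refuted in tree (`Literature.Topology.FourManifolds.TrisectionRefutation.not_exists_isBalancedTrisection`)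
this implication is vacuous; its statement is unchanged and it is kept only as a deprecated
record.  **Use** `gkTrisection_genus_eq_sum_of_homotopyEquiv_sphere.exists_isBalancedGKTrisection_three_mul`
(below, hypothesis `exists_isBalancedGKTrisection`). [cite: AbramsGayKirby2018, Cor. 4] -/
@[deprecated "vacuous: its hypothesis hGK : exists_isBalancedTrisection is refuted in tree (Literature.Topology.FourManifolds.TrisectionRefutation.not_exists_isBalancedTrisection); use Literature.Topology.FourManifolds.gkTrisection_genus_eq_sum_of_homotopyEquiv_sphere.exists_isBalancedGKTrisection_three_mul" (since := "2026-08-15")]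
theorem exists_isBalancedTrisection_three_mul
    (h : trisection_genus_eq_sum_of_homotopyEquiv_sphere.{0}) (hGK : exists_isBalancedTrisection.{0})
    (M : HomotopySphere 4) [ConnectedSpace M.carrier] :
    ∃ (k : ℕ) (T : Fin 3 → Set M.carrier), IsBalancedTrisection M.carrier (3 * k) k T := by
  obtain ⟨g, k, T, -, hT⟩ := hGK M.carrier M.orientation
  obtain rfl : g = 3 * k := h.homotopySphere M g k T hT
  exact ⟨k, T, hT⟩

end trisection_genus_eq_sum_of_homotopyEquiv_sphere

/-! ### Over Gay–Kirby trisections with corners (`IsGKTrisection`) -/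

/-- **Gay–Kirby 2016, Remark 2 / Meier–Schirmer–Zupan 2016, Remark 3.12 (Euler characteristic of
a trisection), homotopy-sphere form, over the corrected predicate `IsGKTrisection`.**
Let `X` be a closed, oriented smooth 4-manifold with a `(g; k₀, k₁, k₂)`-trisection
`S : Fin 3 → Set X` in the sense of `Literature.Topology.FourManifolds.IsGKTrisection` (sectors
with corners along the central surface, Gay–Kirby Def. 1; unbalanced form MSZ Def. 1.1).
Gay–Kirby, Remark 2 (balanced case): "`χ(X) = 2 + g − 3k`"; Meier–Schirmer–Zupan, Remark 3.12:
the induced handle decomposition (one `0`-handle, `k₁` `1`-handles, `g − k₂` `2`-handles, `k₃`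
`3`-handles, one `4`-handle, §4) yields `χ(X) = 2 + g − k₁ − k₂ − k₃`, and "it follows that any
trisection of `S⁴` must satisfy `g = k₁ + k₂ + k₃`".  If `X` is homotopy equivalent to `S⁴`
then `χ(X) = χ(S⁴) = 2` (`χ` is a homotopy invariant; this is the passage of Abrams–Gay–Kirby,
proof of Cor. 4), hence `g = k₀ + k₁ + k₂`.  Vendored in this `χ`-free form because neither
Mathlib nor the tree has the Euler characteristic of a manifold; `X` connected follows from
`X ≃ₕ S⁴` and is not assumed.  This is `trisection_genus_eq_sum_of_homotopyEquiv_sphere` with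
`IsTrisection` (unsatisfiable) replaced by `IsGKTrisection` (non-vacuous), so that it keeps its
printed strength.  Users take `(h : gkTrisection_genus_eq_sum_of_homotopyEquiv_sphere)`.
[cite: GayKirby2016, Remark 2] [cite: MeierSchirmerZupan2016, Remark 3.12]
[cite: AbramsGayKirby2018, Cor. 4] -/
def gkTrisection_genus_eq_sum_of_homotopyEquiv_sphere : Prop :=
  ∀ (X : Type u) [TopologicalSpace X] [T2Space X] [SecondCountableTopology X]
    [ChartedSpace (EuclideanSpace ℝ (Fin 4)) X] [IsManifold (𝓡 4) ∞ X] [CompactSpace X]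
    (_ : SmoothOrientation (𝓡 4) X) (g : ℕ) (k : Fin 3 → ℕ) (S : Fin 3 → Set X),
    IsGKTrisection X g k S → X ≃ₕ 𝕊⁴ → g = k 0 + k 1 + k 2

namespace gkTrisection_genus_eq_sum_of_homotopyEquiv_sphere

/-- Balanced form over `IsBalancedGKTrisection` (Gay–Kirby Remark 2 with `χ = 2`;
Abrams–Gay–Kirby, proof of Cor. 4): a `(g, k)`-trisection of a closed oriented smooth 4-manifold
homotopy equivalent to `S⁴` has `g = 3k`. [cite: GayKirby2016, Remark 2] -/
theorem balanced (h : gkTrisection_genus_eq_sum_of_homotopyEquiv_sphere.{u})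
    (X : Type u) [TopologicalSpace X] [T2Space X] [SecondCountableTopology X]
    [ChartedSpace (EuclideanSpace ℝ (Fin 4)) X] [IsManifold (𝓡 4) ∞ X] [CompactSpace X]
    (o : SmoothOrientation (𝓡 4) X) {g k : ℕ} {S : Fin 3 → Set X}
    (hS : IsBalancedGKTrisection X g k S) (e : X ≃ₕ 𝕊⁴) : g = 3 * k := by
  have := h X o g (fun _ => k) S hS.isGKTrisection e
  omega

/-- Over the tree's oriented homotopy 4-spheres `HomotopySphere 4`: every balanced
`(g, k)`-trisection (with corners) of a homotopy 4-sphere has `g = 3k`.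
[cite: AbramsGayKirby2018, Cor. 4] -/
theorem homotopySphere (h : gkTrisection_genus_eq_sum_of_homotopyEquiv_sphere.{0})
    (M : HomotopySphere 4) (g k : ℕ) (T : Fin 3 → Set M.carrier)
    (hT : IsBalancedGKTrisection M.carrier g k T) : g = 3 * k :=
  h.balanced M.carrier M.orientation hT (Classical.choice M.nonempty_homotopyEquiv)

/-- Unbalanced consequence: each `kᵢ` is at most the genus, for a trisected homotopy 4-sphere.
[cite: MeierSchirmerZupan2016, Remark 3.12] -/
theorem le (h : gkTrisection_genus_eq_sum_of_homotopyEquiv_sphere.{u})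
    (X : Type u) [TopologicalSpace X] [T2Space X] [SecondCountableTopology X]
    [ChartedSpace (EuclideanSpace ℝ (Fin 4)) X] [IsManifold (𝓡 4) ∞ X] [CompactSpace X]
    (o : SmoothOrientation (𝓡 4) X) {g : ℕ} {k : Fin 3 → ℕ} {S : Fin 3 → Set X}
    (hS : IsGKTrisection X g k S) (e : X ≃ₕ 𝕊⁴) (i : Fin 3) : k i ≤ g := by
  have := h X o g k S hS e
  fin_cases i <;> simp only [Fin.zero_eta, Fin.mk_one, Fin.reduceFinMk] <;> omega

/-- Balanced trisected homotopy 4-spheres have genus divisible by `3`; e.g. a homotopy 4-sphere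
has no balanced trisection (with corners) of genus `1` or `2`. [cite: GayKirby2016, Remark 2] -/
theorem three_dvd (h : gkTrisection_genus_eq_sum_of_homotopyEquiv_sphere.{u})
    (X : Type u) [TopologicalSpace X] [T2Space X] [SecondCountableTopology X]
    [ChartedSpace (EuclideanSpace ℝ (Fin 4)) X] [IsManifold (𝓡 4) ∞ X] [CompactSpace X]
    (o : SmoothOrientation (𝓡 4) X) {g k : ℕ} {S : Fin 3 → Set X}
    (hS : IsBalancedGKTrisection X g k S) (e : X ≃ₕ 𝕊⁴) : 3 ∣ g :=
  ⟨k, h.balanced X o hS e⟩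

/-- **Low genus lies in the Meier–Schirmer–Zupan range.** A trisected homotopy 4-sphere of genus
`g ≤ 2` has a sector with `kᵢ ≥ g − 1` one-handles (formally `g ≤ kᵢ + 1`): by
`g = k₀ + k₁ + k₂` the possible types are `(0; 0,0,0)`, `(1; 1,0,0)`, `(2; 2,0,0)` and
`(2; 1,1,0)` up to relabelling the sectors — exactly the hypothesis "`k₁ ≥ g − 1`" of
Meier–Schirmer–Zupan's Thm. 1.2, so that NO input from the classification of `(2; 0,0,0)`-
trisections (Meier–Zupan) is needed for homotopy 4-spheres of trisection genus `≤ 2` (used in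
`Literature/Barriers/SmoothPoincare4/LowGenusTrisectionsStandard.lean`).  Elementary arithmetic
from the fact. [cite: MeierSchirmerZupan2016, Remark 3.12 and Thm. 1.2] -/
theorem exists_le_add_one_of_le_two (h : gkTrisection_genus_eq_sum_of_homotopyEquiv_sphere.{u})
    (X : Type u) [TopologicalSpace X] [T2Space X] [SecondCountableTopology X]
    [ChartedSpace (EuclideanSpace ℝ (Fin 4)) X] [IsManifold (𝓡 4) ∞ X] [CompactSpace X]
    (o : SmoothOrientation (𝓡 4) X) {g : ℕ} {k : Fin 3 → ℕ} {S : Fin 3 → Set X}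
    (hS : IsGKTrisection X g k S) (e : X ≃ₕ 𝕊⁴) (hg : g ≤ 2) : ∃ i, g ≤ k i + 1 := by
  have := h X o g k S hS e
  by_cases h0 : g ≤ k 0 + 1
  · exact ⟨0, h0⟩
  by_cases h1 : g ≤ k 1 + 1
  · exact ⟨1, h1⟩
  exact ⟨2, by omega⟩

/-- With Gay–Kirby's existence theorem over the corrected predicate
(`exists_isBalancedGKTrisection`, GK Thm. 4): every connected homotopy 4-sphere admits a
`(3k, k)`-trisection (with corners) for some `k` — the passage used by Abrams–Gay–Kirby, Cor. 4.
[cite: AbramsGayKirby2018, Cor. 4] -/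
theorem exists_isBalancedGKTrisection_three_mul
    (h : gkTrisection_genus_eq_sum_of_homotopyEquiv_sphere.{0})
    (hGK : exists_isBalancedGKTrisection.{0})
    (M : HomotopySphere 4) [ConnectedSpace M.carrier] :
    ∃ (k : ℕ) (T : Fin 3 → Set M.carrier), IsBalancedGKTrisection M.carrier (3 * k) k T := by
  obtain ⟨g, k, T, -, hT⟩ := hGK M.carrier M.orientation
  obtain rfl : g = 3 * k := h.homotopySphere M g k T hT
  exact ⟨k, T, hT⟩

end gkTrisection_genus_eq_sum_of_homotopyEquiv_sphere

end Literature.Topology.FourManifolds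

end
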